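import Summits.HodgeConjecture.HodgeConjecture.Theorems.F0P2oYCoinvariantsOfFrameAssembly   -- ★ p831955: brings `reIm`, `IsQuadraticCoordinates`, `alt`/`polar`, `dotProductBilin`
import HarnessLib

/-!
# Crux `H413`, programme P2, N3 road (a)-block (E3) — THE LINE FIBRE CHART: a symplectic isomorphism of the rank-one model `(S^ι, β_{T₁})` (one
# coordinate, `T₁ = (t₁)`) onto the dot fibre `F × F` of the `Y`-adapted chart, reading `c ↦ (a₀⁻¹·re(κc), im(κc))`, for any `κ` with `N(κ) = a₀ t₁`

Cell hodgecm-mathlib (D-0151), FLOOR 0, crux item H413 = stmt-HodgeConjecture-24833, programme P2; N3 road (`F0/P2/B-p18/g28/N3-ROAD.v2.B-p18g28.md`),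
(a)-block, row (S5) «THE DICTIONARY» (lead B-p18 (g28) 20:49:54Z, desk F0P2-plan (g8) 20:50:18Z ∕ 21:29:25Z), seat F0P2-p01 (g8), brick (E3-gen).  THEOREMS ONLY
(no `def`, no instance, no notation, no named fact, no `sorry`); never imports a `Cruxes/…/Lines` module; kernel lane `--supports stmt-HodgeConjecture-24833 --as helper`.
HC_CM is proved only modulo the printed citations until rung 0 closes; nothing printed is asserted here.

THE MATHEMATICS.  In the `Y`-adapted chart `Γ` of ★ p835177 ∕ (E1-CM) the `𝕎₁ = Y^⊥ ∕ Y`-coordinates of a vector `x` are `(a₀⁻¹·re⟨b, x⟩, im⟨b, x⟩)`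
(`⟨b, b⟩ = φ(a₀)`), and the centre `u·1` of `U(V)(L⁺_v)` acts there through `z = ⟨b, x⟩ ↦ β z`.  The rank-one Weil representation `ω¹ = lineWeilCM` lives on the
Schrödinger model of `(S^ι, β_{T₁})`, `ι` a ONE-element index type, `T₁ = (t₁)`, where `u` acts by `c ↦ β c`.  For every `κ ∈ S` with `N(κ) = re(κ)² − d·im(κ)² = a₀ t₁`
the map **`Γ₁ : reIm c ↦ (a₀⁻¹·re(κ c), im(κ c))`** is an `F`-LINEAR ISOMORPHISM `F^ι × F^ι ≃ F × F` which is SYMPLECTIC (`alt β_dot ∘ Γ₁ = alt β_{T₁}`: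
`a₀⁻¹ N(κ) = t₁`) and `E`-equivariant (`κ β = β κ`).  In the N3 (a) dictionary `a₀ = a·ε` (the frame unit), `t₁ = −d₁d₂d₃·ε` (the kernel line times `ε`) and
`a₀ t₁ = N(a² ε ∕ det T)` by the determinant of the form congruence `ᵗT̄ · diag dV · T = a·Φ₃` (`a³ = −d₁d₂d₃ · N(det T)`) — the norm-class identity behind
«the Witt kernel line of `diag dV` is `⟨−d₁d₂d₃⟩`» [Jacobowitz1962, Thm. 3.1].  With ★ `exists_intertwiner_implements_conj` over `Γ₁` the rank-one package is
transported to the dot fibre model, where (E2) ★ `F0P2oFibreDescentImplementer` and ★ A-p12 `F0P2oDictionaryUpToCharacter` compare it with the descended centre action.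

* `exists_lineFibreChart` — existence of `Γ₁` with its formula on `reIm`, surjectivity in the form `∀ p, ∃ c, Γ₁ (reIm c) = p`, and the `alt`-identity.
[Weil1964, n° 34 («changement de base»); MoeglinVignerasWaldspurger1987, Chap. 2 I.4; Jacobowitz1962, Thm. 3.1.]

## References
* [Weil1964] A. Weil, Acta Math. 111 (1964): n° 5, n° 34.
* [MoeglinVignerasWaldspurger1987] C. Mœglin, M.-F. Vignéras, J.-L. Waldspurger, LNM 1291 (1987): Chap. 2 I.4.
* [Jacobowitz1962] R. Jacobowitz, *Hermitian forms over local fields*, Amer. J. Math. 84 (1962): Thm. 3.1.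
-/

set_option autoImplicit false
set_option linter.dupNamespace false -- the mandated namespace repeats the single-problem summit's segment

noncomputable section

open _root_.Matrix
open Literature.NumberTheory.Automorphic Literature.NumberTheory.Automorphic.UnitaryGroup
open Literature.NumberTheory.Automorphic.UnitaryGroup.QuadraticCoordinates Literature.NumberTheory.Automorphic.UnitaryGroup.IsQuadraticCoordinates
open Literature.RepresentationTheory Literature.RepresentationTheory.HeisenbergGroup

namespace Summit.HodgeConjecture.HodgeConjecture.Cruxes.H413.F0P2oLineFibreChart

variable {F : Type*} [Field F] {S : Type*} [CommRing S] {φ : F →+* S} {Ψq : (F × F) ≃+ S} {δ : S} {d : F}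
  (hq : IsQuadraticCoordinates φ Ψq δ d) {ι : Type*} [Fintype ι] [DecidableEq ι] (eι : ι ≃ Fin 1)

include hq in
/-- **THE LINE FIBRE CHART.**  For a one-element index type `ι` (`eι : ι ≃ Fin 1`), a `1 × 1` Gram matrix `T₁` with entry `t₁ ≠ 0` at `i₀ = eι⁻¹ 0`, a unit
`a₀ ≠ 0` and `κ ∈ S` with `re(κ)² − d·im(κ)² = a₀·t₁`, there is an `F`-linear isomorphism `Γ₁ : F^ι × F^ι ≃ F^{Fin 1} × F^{Fin 1}` with
`Γ₁ (reIm c) = (a₀⁻¹·re(κ·c i₀), im(κ·c i₀))`, onto (`∀ p, ∃ c, Γ₁ (reIm c) = p`), and symplectic: `alt β_dot (Γ₁ w) (Γ₁ w′) = alt β_{T₁} w w′`.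
[cite: Weil1964, n° 34] [cite: MoeglinVignerasWaldspurger1987, Chap. 2 I.4] [cite: Jacobowitz1962, Thm. 3.1] -/
theorem exists_lineFibreChart (T₁ : Matrix ι ι F) {t₁ a₀ : F} (hT₁ : T₁ (eι.symm 0) (eι.symm 0) = t₁) (ht₁ : t₁ ≠ 0) (ha₀ : a₀ ≠ 0)
    (κ : S) (hκ : re Ψq κ * re Ψq κ - d * (im Ψq κ * im Ψq κ) = a₀ * t₁) :
    ∃ Γ₁ : ((ι → F) × (ι → F)) ≃ₗ[F] ((Fin 1 → F) × (Fin 1 → F)),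
      (∀ c : ι → S, Γ₁ (reIm Ψq ι c) = (fun _ => a₀⁻¹ * re Ψq (κ * c (eι.symm 0)), fun _ => im Ψq (κ * c (eι.symm 0)))) ∧
      (∀ p : (Fin 1 → F) × (Fin 1 → F), ∃ c : ι → S, Γ₁ (reIm Ψq ι c) = p) ∧
      ∀ w w' : (ι → F) × (ι → F),
        alt (polar (dotProductBilin F F (m := Fin 1))) (Γ₁ w) (Γ₁ w') = alt (polar (Matrix.toLinearMap₂' F T₁)) w w' := by
  classical
  -- the one index
  have hι : ∀ i : ι, i = eι.symm 0 := fun i => eι.injective (Subsingleton.elim _ _)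
  have hsum : ∀ f : ι → F, ∑ i, f i = f (eι.symm 0) := fun f =>
    Fintype.sum_eq_single (eι.symm 0) fun j hj => absurd (hι j) hj
  -- the entries of `κ` and the norm
  set k₁ := re Ψq κ with hk₁
  set k₂ := im Ψq κ with hk₂
  have hN : k₁ * k₁ - d * (k₂ * k₂) ≠ 0 := by rw [hκ]; exact mul_ne_zero ha₀ ht₁
  -- forward and backward linear maps
  let f : ((ι → F) × (ι → F)) →ₗ[F] ((Fin 1 → F) × (Fin 1 → F)) :=
    { toFun := fun w => (fun _ => a₀⁻¹ * (k₁ * w.1 (eι.symm 0) + d * k₂ * w.2 (eι.symm 0)),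
        fun _ => k₂ * w.1 (eι.symm 0) + k₁ * w.2 (eι.symm 0))
      map_add' := fun w w' => by
        ext <;> simp only [Prod.fst_add, Prod.snd_add, Pi.add_apply] <;> ring
      map_smul' := fun r w => by
        ext <;> simp only [Prod.smul_fst, Prod.smul_snd, Pi.smul_apply, smul_eq_mul, RingHom.id_apply] <;> ring }
  have hXN : (k₁ * k₁ - d * (k₂ * k₂)) * (k₁ * k₁ - d * (k₂ * k₂))⁻¹ = 1 := mul_inv_cancel₀ hN
  have ha : a₀ * a₀⁻¹ = 1 := mul_inv_cancel₀ ha₀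
  let g : ((Fin 1 → F) × (Fin 1 → F)) →ₗ[F] ((ι → F) × (ι → F)) :=
    { toFun := fun p => (fun _ => (k₁ * k₁ - d * (k₂ * k₂))⁻¹ * (k₁ * (a₀ * p.1 0) - d * k₂ * p.2 0),
        fun _ => (k₁ * k₁ - d * (k₂ * k₂))⁻¹ * (k₁ * p.2 0 - k₂ * (a₀ * p.1 0)))
      map_add' := fun p p' => by
        ext <;> simp only [Prod.fst_add, Prod.snd_add, Pi.add_apply] <;> ring
      map_smul' := fun r p => by
        ext <;> simp only [Prod.smul_fst, Prod.smul_snd, Pi.smul_apply, smul_eq_mul, RingHom.id_apply] <;> ring }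
  have hfg : f ∘ₗ g = LinearMap.id := by
    refine LinearMap.ext fun p => Prod.ext (funext fun j => ?_) (funext fun j => ?_)
    · have hj : j = 0 := Subsingleton.elim _ _
      subst hj
      change a₀⁻¹ * (k₁ * ((k₁ * k₁ - d * (k₂ * k₂))⁻¹ * (k₁ * (a₀ * p.1 0) - d * k₂ * p.2 0)) +
        d * k₂ * ((k₁ * k₁ - d * (k₂ * k₂))⁻¹ * (k₁ * p.2 0 - k₂ * (a₀ * p.1 0)))) = p.1 0
      linear_combination (p.1 0 * a₀⁻¹ * a₀) * hXN + p.1 0 * ha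
    · have hj : j = 0 := Subsingleton.elim _ _
      subst hj
      change k₂ * ((k₁ * k₁ - d * (k₂ * k₂))⁻¹ * (k₁ * (a₀ * p.1 0) - d * k₂ * p.2 0)) +
        k₁ * ((k₁ * k₁ - d * (k₂ * k₂))⁻¹ * (k₁ * p.2 0 - k₂ * (a₀ * p.1 0))) = p.2 0
      linear_combination (p.2 0) * hXN
  have hgf : g ∘ₗ f = LinearMap.id := by
    refine LinearMap.ext fun w => Prod.ext (funext fun i => ?_) (funext fun i => ?_)
    · rw [hι i]
      change (k₁ * k₁ - d * (k₂ * k₂))⁻¹ * (k₁ * (a₀ * (a₀⁻¹ * (k₁ * w.1 (eι.symm 0) + d * k₂ * w.2 (eι.symm 0)))) -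
        d * k₂ * (k₂ * w.1 (eι.symm 0) + k₁ * w.2 (eι.symm 0))) = w.1 (eι.symm 0)
      linear_combination (w.1 (eι.symm 0)) * hXN +
        (k₁ * k₁ - d * (k₂ * k₂))⁻¹ * k₁ * (k₁ * w.1 (eι.symm 0) + d * k₂ * w.2 (eι.symm 0)) * ha
    · rw [hι i]
      change (k₁ * k₁ - d * (k₂ * k₂))⁻¹ * (k₁ * (k₂ * w.1 (eι.symm 0) + k₁ * w.2 (eι.symm 0)) -
        k₂ * (a₀ * (a₀⁻¹ * (k₁ * w.1 (eι.symm 0) + d * k₂ * w.2 (eι.symm 0))))) = w.2 (eι.symm 0)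
      linear_combination (w.2 (eι.symm 0)) * hXN -
        (k₁ * k₁ - d * (k₂ * k₂))⁻¹ * k₂ * (k₁ * w.1 (eι.symm 0) + d * k₂ * w.2 (eι.symm 0)) * ha
  refine ⟨LinearEquiv.ofLinear f g hfg hgf, fun c => ?_, fun p => ?_, fun w w' => ?_⟩
  · -- the formula on `reIm c`: `re(κ c) = k₁ re c + d k₂ im c`, `im(κ c) = k₁ im c + k₂ re c`
    refine Prod.ext (funext fun _ => ?_) (funext fun _ => ?_)
    · change a₀⁻¹ * (k₁ * (reIm Ψq ι c).1 (eι.symm 0) + d * k₂ * (reIm Ψq ι c).2 (eι.symm 0)) = a₀⁻¹ * re Ψq (κ * c (eι.symm 0))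
      rw [reIm_apply_fst, reIm_apply_snd, hq.re_mul]
      ring
    · change k₂ * (reIm Ψq ι c).1 (eι.symm 0) + k₁ * (reIm Ψq ι c).2 (eι.symm 0) = im Ψq (κ * c (eι.symm 0))
      rw [reIm_apply_fst, reIm_apply_snd, hq.im_mul]
      ring
  · -- onto: `reIm` and `Γ₁` are bijections
    refine ⟨(reIm Ψq ι).symm (g p), ?_⟩
    rw [AddEquiv.apply_symm_apply]
    exact congrArg (fun L : ((Fin 1 → F) × (Fin 1 → F)) →ₗ[F] ((Fin 1 → F) × (Fin 1 → F)) => L p) hfg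
  · -- symplectic: `a₀⁻¹ (k₁² − d k₂²) = t₁`
    rw [alt_apply, alt_apply, polar_apply, polar_apply, polar_apply, polar_apply, dotProductBilin_apply_apply, dotProductBilin_apply_apply,
      Matrix.toLinearMap₂'_apply', Matrix.toLinearMap₂'_apply']
    change (fun _ : Fin 1 => a₀⁻¹ * (k₁ * w.1 (eι.symm 0) + d * k₂ * w.2 (eι.symm 0))) ⬝ᵥ (fun _ : Fin 1 => k₂ * w'.1 (eι.symm 0) + k₁ * w'.2 (eι.symm 0)) -
        (fun _ : Fin 1 => a₀⁻¹ * (k₁ * w'.1 (eι.symm 0) + d * k₂ * w'.2 (eι.symm 0))) ⬝ᵥ (fun _ : Fin 1 => k₂ * w.1 (eι.symm 0) + k₁ * w.2 (eι.symm 0)) =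
      w.1 ⬝ᵥ (T₁ *ᵥ w'.2) - w'.1 ⬝ᵥ (T₁ *ᵥ w.2)
    simp only [dotProduct, Fin.sum_univ_one, Matrix.mulVec, hsum, hT₁]
    have hinv : a₀⁻¹ * (k₁ * k₁ - d * (k₂ * k₂)) = t₁ := by rw [hκ, ← mul_assoc, inv_mul_cancel₀ ha₀, one_mul]
    linear_combination (w.1 (eι.symm 0) * w'.2 (eι.symm 0) - w'.1 (eι.symm 0) * w.2 (eι.symm 0)) * hinv

end Summit.HodgeConjecture.HodgeConjecture.Cruxes.H413.F0P2oLineFibreChart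

end
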